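import Mathlib
import Summits.Ventures.PercRepro2.A3CutCrossShield
import Summits.Ventures.PercRepro2.RootCutSides

/-!
# The cross-shield, (FM) — the `U`-sums and the closed form `FMfun(x) = 2 A₁ X Y / P(Q)²`
(blind cell PercRepro2, night-1 g33; proofs/NIGHT1-G33.md §7; census 198/198 for the closed form —
mining/night-1/g33/check_cross_fm.py; the Harris step is A3CutCrossFM.lean)

Setting of A3CutCrossShield (`x` a cut vertex separating `{a₁, o}` from `{a₂, b}`).  With the two
further atoms `Ao₁ = ∑_{S ∋ a₁} α_o(S)` and `Ao₀ = ∑_{S ∌ a₁, o ∈ S} α(S)`, the `U`-sums are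
`∑_W Su_o = B₂ (Aρ₀ + Ao₀) + B₀ (Ao₁ + Aρ₀)` and `∑_W Su_b = Bβ₂ A₀ + (Bb₀ + Bβ₀) A₁ + Bβ₀ A₀`
(`sum_Su_o_cross`, `sum_Su_b_cross`), the `B`-side cluster events partition every `B`-event
(`sum_prob_sideB_cluster_TT`), `B₀ + B₂ = 1` (`B_total`), and the first-order functional is
**`FMfun(x) = 2 A₁ · X · Y / P(Q)²`** (`FMfun_cross_eq`) with `X = B₀ (A₀ Ao₁ − A₁ Aρ₀) + B₂ A₀ Ao₀`,
`Y = Bβ₂ B₀ + B₂ (Bb₀ − Bβ₀)`.  Standard axioms.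
-/

namespace Summit.Ventures.PercRepro2

open UnionCluster CovForm CutV

namespace CovForm

namespace A3Fibre

namespace CrossShield

section FM

variable {V : Type*} {E : Type*} [Fintype V] [DecidableEq V] [Fintype E] [DecidableEq E]
  {R : Type*} [Field R] [LinearOrder R] [IsStrictOrderedRing R] {ends : E → Sym2 V} {x : V}
  {VA VB : Finset V} {EA EB : Set E} [DecidablePred (· ∈ EA)] [DecidablePred (· ∈ EB)] {p : E → R}
  {a₁ a₂ o b : V}

/-! ## The two `U`-sums -/

omit [Fintype V] [LinearOrder R] [IsStrictOrderedRing R] in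
/-- `∑_S Su_o` at `T ∋ a₂`: `μ(T)(Aρ₀ + Ao₀)`. -/
lemma sum_S_Su_o_of_mem (h : IsCut ends x ↑VA ↑VB EA EB) (ha1 : a₁ ∈ VA) (ho : o ∈ VA)
    (ha2 : a₂ ∈ insert x VB) {T : Finset V} (hT : T ⊆ insert x VB) (hxT : x ∈ T) (h2 : a₂ ∈ T) :
    ∑ S ∈ VA.powerset, Su p ends a₁ a₂ x o (S ∪ T) =
      muT p ends EB x T *
        (∑ S ∈ VA.powerset.filter (fun S => a₁ ∉ S), alphaO p ends EA x a₁ o S +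
          ∑ S ∈ VA.powerset.filter (fun S => a₁ ∉ S), (if o ∈ S then alphaS p ends EA x S else 0)) := by
  rw [sum_S_restrict _ fun S hS h1 =>
    (masses_cross_zero h ha1 ha2 (Finset.mem_powerset.1 hS) hT hxT h1 h2 o).2.2, ← Finset.sum_add_distrib,
    Finset.mul_sum]
  refine Finset.sum_congr rfl fun S hS => ?_
  rw [Finset.mem_filter, Finset.mem_powerset] at hS
  rw [Su_o_cross h ha1 ho ha2 hS.1 hT hxT (fun hc => hS.2 hc.1)]
  by_cases hoS : o ∈ S
  · rw [if_pos (show o ∈ S ∧ a₂ ∈ T from ⟨hoS, h2⟩), if_pos hoS]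
    ring
  · rw [if_neg (show ¬ (o ∈ S ∧ a₂ ∈ T) from fun hc => hoS hc.1), if_neg hoS]
    ring

omit [Fintype V] [LinearOrder R] [IsStrictOrderedRing R] in
/-- `∑_S Su_o` at `T ∌ a₂`: `μ(T)(Ao₁ + Aρ₀)`. -/
lemma sum_S_Su_o_of_notMem (h : IsCut ends x ↑VA ↑VB EA EB) (ha1 : a₁ ∈ VA) (ho : o ∈ VA)
    (ha2 : a₂ ∈ insert x VB) {T : Finset V} (hT : T ⊆ insert x VB) (hxT : x ∈ T) (h2 : a₂ ∉ T) :
    ∑ S ∈ VA.powerset, Su p ends a₁ a₂ x o (S ∪ T) =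
      muT p ends EB x T *
        (∑ S ∈ VA.powerset.filter (fun S => a₁ ∈ S), alphaO p ends EA x a₁ o S +
          ∑ S ∈ VA.powerset.filter (fun S => a₁ ∉ S), alphaO p ends EA x a₁ o S) := by
  rw [sum_S_split, mul_add, Finset.mul_sum, Finset.mul_sum]
  congr 1
  · refine Finset.sum_congr rfl fun S hS => ?_
    rw [Finset.mem_filter, Finset.mem_powerset] at hS
    rw [Su_o_cross h ha1 ho ha2 hS.1 hT hxT (fun hc => h2 hc.2),
      if_neg (show ¬ (o ∈ S ∧ a₂ ∈ T) from fun hc => h2 hc.2)]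
    ring
  · refine Finset.sum_congr rfl fun S hS => ?_
    rw [Finset.mem_filter, Finset.mem_powerset] at hS
    rw [Su_o_cross h ha1 ho ha2 hS.1 hT hxT (fun hc => h2 hc.2),
      if_neg (show ¬ (o ∈ S ∧ a₂ ∈ T) from fun hc => h2 hc.2)]
    ring

omit [Fintype V] [LinearOrder R] [IsStrictOrderedRing R] in
/-- `∑_S Su_b` at `T ∋ a₂`: `μ_b(T) A₀`. -/
lemma sum_S_Su_b_of_mem (h : IsCut ends x ↑VA ↑VB EA EB) (ha1 : a₁ ∈ VA) (ha2 : a₂ ∈ insert x VB)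
    (hb : b ∈ insert x VB) {T : Finset V} (hT : T ⊆ insert x VB) (hxT : x ∈ T) (h2 : a₂ ∈ T) :
    ∑ S ∈ VA.powerset, Su p ends a₁ a₂ x b (S ∪ T) =
      muB p ends EB x a₂ b T * ∑ S ∈ VA.powerset.filter (fun S => a₁ ∉ S), alphaS p ends EA x S := by
  rw [sum_S_restrict _ fun S hS h1 =>
    (masses_cross_zero h ha1 ha2 (Finset.mem_powerset.1 hS) hT hxT h1 h2 b).2.2, Finset.mul_sum]
  refine Finset.sum_congr rfl fun S hS => ?_
  rw [Finset.mem_filter, Finset.mem_powerset] at hS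
  rw [Su_b_cross h ha1 ha2 hb hS.1 hT hxT (fun hc => hS.2 hc.1),
    if_neg (show ¬ (a₁ ∈ S ∧ b ∈ T) from fun hc => hS.2 hc.1)]
  ring

omit [Fintype V] [LinearOrder R] [IsStrictOrderedRing R] in
/-- `∑_S Su_b` at `T ∌ a₂`: `([b ∈ T] μ(T) + μ_b(T)) A₁ + μ_b(T) A₀`. -/
lemma sum_S_Su_b_of_notMem (h : IsCut ends x ↑VA ↑VB EA EB) (ha1 : a₁ ∈ VA)
    (ha2 : a₂ ∈ insert x VB) (hb : b ∈ insert x VB) {T : Finset V} (hT : T ⊆ insert x VB)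
    (hxT : x ∈ T) (h2 : a₂ ∉ T) :
    ∑ S ∈ VA.powerset, Su p ends a₁ a₂ x b (S ∪ T) =
      ((if b ∈ T then muT p ends EB x T else 0) + muB p ends EB x a₂ b T) *
          ∑ S ∈ VA.powerset.filter (fun S => a₁ ∈ S), alphaS p ends EA x S +
        muB p ends EB x a₂ b T * ∑ S ∈ VA.powerset.filter (fun S => a₁ ∉ S), alphaS p ends EA x S := by
  rw [sum_S_split, Finset.mul_sum, Finset.mul_sum]
  congr 1
  · refine Finset.sum_congr rfl fun S hS => ?_
    rw [Finset.mem_filter, Finset.mem_powerset] at hS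
    rw [Su_b_cross h ha1 ha2 hb hS.1 hT hxT (fun hc => h2 hc.2)]
    by_cases hbT : b ∈ T
    · rw [if_pos (show a₁ ∈ S ∧ b ∈ T from ⟨hS.2, hbT⟩), if_pos hbT]
    · rw [if_neg (show ¬ (a₁ ∈ S ∧ b ∈ T) from fun hc => hbT hc.2), if_neg hbT]
  · refine Finset.sum_congr rfl fun S hS => ?_
    rw [Finset.mem_filter, Finset.mem_powerset] at hS
    rw [Su_b_cross h ha1 ha2 hb hS.1 hT hxT (fun hc => h2 hc.2),
      if_neg (show ¬ (a₁ ∈ S ∧ b ∈ T) from fun hc => hS.2 hc.1)]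
    ring

omit [LinearOrder R] [IsStrictOrderedRing R] in
/-- `∑_W Su_o W = B₂ (Aρ₀ + Ao₀) + B₀ (Ao₁ + Aρ₀)`. -/
lemma sum_Su_o_cross (h : IsCut ends x ↑VA ↑VB EA EB) (ha1 : a₁ ∈ VA) (ho : o ∈ VA)
    (ha2 : a₂ ∈ insert x VB) :
    ∑ W : Finset V, Su p ends a₁ a₂ x o W =
      (∑ T ∈ ((insert x VB).powerset.filter (fun T => x ∈ T)).filter (fun T => a₂ ∈ T),
          muT p ends EB x T) *
        (∑ S ∈ VA.powerset.filter (fun S => a₁ ∉ S), alphaO p ends EA x a₁ o S +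
          ∑ S ∈ VA.powerset.filter (fun S => a₁ ∉ S), (if o ∈ S then alphaS p ends EA x S else 0)) +
      (∑ T ∈ ((insert x VB).powerset.filter (fun T => x ∈ T)).filter (fun T => a₂ ∉ T),
          muT p ends EB x T) *
        (∑ S ∈ VA.powerset.filter (fun S => a₁ ∈ S), alphaO p ends EA x a₁ o S +
          ∑ S ∈ VA.powerset.filter (fun S => a₁ ∉ S), alphaO p ends EA x a₁ o S) := by
  have e2 : ∑ T ∈ ((insert x VB).powerset.filter (fun T => x ∈ T)).filter (fun T => a₂ ∈ T),
        ∑ S ∈ VA.powerset, Su p ends a₁ a₂ x o (S ∪ T) =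
      ∑ T ∈ ((insert x VB).powerset.filter (fun T => x ∈ T)).filter (fun T => a₂ ∈ T),
        muT p ends EB x T *
          (∑ S ∈ VA.powerset.filter (fun S => a₁ ∉ S), alphaO p ends EA x a₁ o S +
            ∑ S ∈ VA.powerset.filter (fun S => a₁ ∉ S), (if o ∈ S then alphaS p ends EA x S else 0)) :=
    Finset.sum_congr rfl fun T hT => by
      obtain ⟨⟨hT', hxT⟩, h2⟩ := mem_TT2 hT
      exact sum_S_Su_o_of_mem h ha1 ho ha2 hT' hxT h2
  have e0 : ∑ T ∈ ((insert x VB).powerset.filter (fun T => x ∈ T)).filter (fun T => a₂ ∉ T),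
        ∑ S ∈ VA.powerset, Su p ends a₁ a₂ x o (S ∪ T) =
      ∑ T ∈ ((insert x VB).powerset.filter (fun T => x ∈ T)).filter (fun T => a₂ ∉ T),
        muT p ends EB x T *
          (∑ S ∈ VA.powerset.filter (fun S => a₁ ∈ S), alphaO p ends EA x a₁ o S +
            ∑ S ∈ VA.powerset.filter (fun S => a₁ ∉ S), alphaO p ends EA x a₁ o S) :=
    Finset.sum_congr rfl fun T hT => by
      obtain ⟨⟨hT', hxT⟩, h2⟩ := mem_TT0 hT
      exact sum_S_Su_o_of_notMem h ha1 ho ha2 hT' hxT h2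
  rw [sum_cross_pairs h a₁ a₂ _ (fun W hW => (masses_eq_zero_of_fibre_eq_empty' (p := p) hW o).2.2),
    sum_T_split (a₂ := a₂), e2, e0, ← Finset.sum_mul, ← Finset.sum_mul]

omit [LinearOrder R] [IsStrictOrderedRing R] in
/-- `∑_W Su_b W = Bβ₂ A₀ + (Bb₀ + Bβ₀) A₁ + Bβ₀ A₀`. -/
lemma sum_Su_b_cross (h : IsCut ends x ↑VA ↑VB EA EB) (ha1 : a₁ ∈ VA) (ha2 : a₂ ∈ insert x VB)
    (hb : b ∈ insert x VB) :
    ∑ W : Finset V, Su p ends a₁ a₂ x b W =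
      (∑ T ∈ ((insert x VB).powerset.filter (fun T => x ∈ T)).filter (fun T => a₂ ∈ T),
          muB p ends EB x a₂ b T) *
        (∑ S ∈ VA.powerset.filter (fun S => a₁ ∉ S), alphaS p ends EA x S) +
      (((∑ T ∈ ((insert x VB).powerset.filter (fun T => x ∈ T)).filter (fun T => a₂ ∉ T),
            (if b ∈ T then muT p ends EB x T else 0)) +
          ∑ T ∈ ((insert x VB).powerset.filter (fun T => x ∈ T)).filter (fun T => a₂ ∉ T),
            muB p ends EB x a₂ b T) *
        (∑ S ∈ VA.powerset.filter (fun S => a₁ ∈ S), alphaS p ends EA x S) +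
      (∑ T ∈ ((insert x VB).powerset.filter (fun T => x ∈ T)).filter (fun T => a₂ ∉ T),
          muB p ends EB x a₂ b T) *
        (∑ S ∈ VA.powerset.filter (fun S => a₁ ∉ S), alphaS p ends EA x S)) := by
  have e2 : ∑ T ∈ ((insert x VB).powerset.filter (fun T => x ∈ T)).filter (fun T => a₂ ∈ T),
        ∑ S ∈ VA.powerset, Su p ends a₁ a₂ x b (S ∪ T) =
      ∑ T ∈ ((insert x VB).powerset.filter (fun T => x ∈ T)).filter (fun T => a₂ ∈ T),
        muB p ends EB x a₂ b T * ∑ S ∈ VA.powerset.filter (fun S => a₁ ∉ S), alphaS p ends EA x S :=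
    Finset.sum_congr rfl fun T hT => by
      obtain ⟨⟨hT', hxT⟩, h2⟩ := mem_TT2 hT
      exact sum_S_Su_b_of_mem h ha1 ha2 hb hT' hxT h2
  have e0 : ∑ T ∈ ((insert x VB).powerset.filter (fun T => x ∈ T)).filter (fun T => a₂ ∉ T),
        ∑ S ∈ VA.powerset, Su p ends a₁ a₂ x b (S ∪ T) =
      ∑ T ∈ ((insert x VB).powerset.filter (fun T => x ∈ T)).filter (fun T => a₂ ∉ T),
        (((if b ∈ T then muT p ends EB x T else 0) + muB p ends EB x a₂ b T) *
            ∑ S ∈ VA.powerset.filter (fun S => a₁ ∈ S), alphaS p ends EA x S +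
          muB p ends EB x a₂ b T * ∑ S ∈ VA.powerset.filter (fun S => a₁ ∉ S), alphaS p ends EA x S) :=
    Finset.sum_congr rfl fun T hT => by
      obtain ⟨⟨hT', hxT⟩, h2⟩ := mem_TT0 hT
      exact sum_S_Su_b_of_notMem h ha1 ha2 hb hT' hxT h2
  rw [sum_cross_pairs h a₁ a₂ _ (fun W hW => (masses_eq_zero_of_fibre_eq_empty' (p := p) hW b).2.2),
    sum_T_split (a₂ := a₂), e2, e0, ← Finset.sum_mul, Finset.sum_add_distrib, ← Finset.sum_mul,
    ← Finset.sum_mul, Finset.sum_add_distrib]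

/-! ## The `B`-side partition and `B₀ + B₂ = 1` -/

omit [LinearOrder R] [IsStrictOrderedRing R] [DecidablePred (· ∈ EA)] in
/-- The `B`-side cluster events `{C_B(x) = T}`, `T ∈ TT`, partition every `B`-side event. -/
lemma sum_prob_sideB_cluster_TT (h : IsCut ends x ↑VA ↑VB EA EB) (Z : Set (Config E)) :
    ∑ T ∈ (insert x VB).powerset.filter (fun T => x ∈ T),
        prob p (sideEvent EB (clusterEvent ends x (↑T : Set V) ∩ Z)) =
      prob p (sideEvent EB Z) := by
  rw [Finset.sum_filter_of_ne]
  · exact RootShield.sum_prob_sideEvent_cluster_inter p EB x (insert x VB) Z fun ω _ v hv => by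
      rcases cluster_restrict_subset h.symm (Or.inr rfl) hv with hvB | hvx
      · exact Finset.mem_coe.2 (Finset.mem_insert_of_mem (Finset.mem_coe.1 hvB))
      · rw [Set.mem_singleton_iff] at hvx
        exact Finset.mem_coe.2 (hvx ▸ Finset.mem_insert_self x VB)
  · intro T _ hne
    by_contra hxT
    apply hne
    rw [clusterEvent_x_eq_empty_of_notMem hxT, Set.empty_inter, RootShield.sideEvent_empty, prob_empty]

omit [LinearOrder R] [IsStrictOrderedRing R] [DecidablePred (· ∈ EA)] in
/-- `B₀ + B₂ = 1`. -/
lemma B_total (h : IsCut ends x ↑VA ↑VB EA EB) :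
    (∑ T ∈ ((insert x VB).powerset.filter (fun T => x ∈ T)).filter (fun T => a₂ ∉ T),
        muT p ends EB x T) +
      ∑ T ∈ ((insert x VB).powerset.filter (fun T => x ∈ T)).filter (fun T => a₂ ∈ T),
        muT p ends EB x T = 1 := by
  rw [add_comm, ← sum_T_split (a₂ := a₂)]
  have key := sum_prob_sideB_cluster_TT (p := p) h (Set.univ : Set (Config E))
  simp only [Set.inter_univ] at key
  have huniv : sideEvent EB (Set.univ : Set (Config E)) = Set.univ := by
    ext ω; simp [mem_sideEvent]
  rw [huniv, prob_univ] at key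
  exact key

/-! ## The closed form of `FMfun` -/

/-- **`FMfun(x) = 2 A₁ X Y / P(Q)²`** in the cross-shield class. -/
theorem FMfun_cross_eq (hp : IsProbVec p) (h : IsCut ends x ↑VA ↑VB EA EB) (ha1 : a₁ ∈ VA)
    (ho : o ∈ VA) (ha2 : a₂ ∈ insert x VB) (hb : b ∈ insert x VB)
    (hQ : prob p (avoidAll ends a₂ {a₁}) ≠ 0) :
    FMfun p ends o a₁ a₂ x b =
      2 * (∑ S ∈ VA.powerset.filter (fun S => a₁ ∈ S), alphaS p ends EA x S) *
        ((∑ T ∈ ((insert x VB).powerset.filter (fun T => x ∈ T)).filter (fun T => a₂ ∉ T),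
              muT p ends EB x T) *
            ((∑ S ∈ VA.powerset.filter (fun S => a₁ ∉ S), alphaS p ends EA x S) *
                (∑ S ∈ VA.powerset.filter (fun S => a₁ ∈ S), alphaO p ends EA x a₁ o S) -
              (∑ S ∈ VA.powerset.filter (fun S => a₁ ∈ S), alphaS p ends EA x S) *
                (∑ S ∈ VA.powerset.filter (fun S => a₁ ∉ S), alphaO p ends EA x a₁ o S)) +
          (∑ T ∈ ((insert x VB).powerset.filter (fun T => x ∈ T)).filter (fun T => a₂ ∈ T),
              muT p ends EB x T) *
            (∑ S ∈ VA.powerset.filter (fun S => a₁ ∉ S), alphaS p ends EA x S) *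
            (∑ S ∈ VA.powerset.filter (fun S => a₁ ∉ S), (if o ∈ S then alphaS p ends EA x S else 0))) *
        ((∑ T ∈ ((insert x VB).powerset.filter (fun T => x ∈ T)).filter (fun T => a₂ ∈ T),
              muB p ends EB x a₂ b T) *
            (∑ T ∈ ((insert x VB).powerset.filter (fun T => x ∈ T)).filter (fun T => a₂ ∉ T),
              muT p ends EB x T) +
          (∑ T ∈ ((insert x VB).powerset.filter (fun T => x ∈ T)).filter (fun T => a₂ ∈ T),
              muT p ends EB x T) *
            ((∑ T ∈ ((insert x VB).powerset.filter (fun T => x ∈ T)).filter (fun T => a₂ ∉ T),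
                (if b ∈ T then muT p ends EB x T else 0)) -
              ∑ T ∈ ((insert x VB).powerset.filter (fun T => x ∈ T)).filter (fun T => a₂ ∉ T),
                muB p ends EB x a₂ b T)) /
        prob p (avoidAll ends a₂ {a₁}) ^ 2 := by
  have hB := B_total (p := p) (a₂ := a₂) h
  have hmUo : LeafStep.mU p ends a₁ a₂ o = ∑ W : Finset V, Su p ends a₁ a₂ x o W := by
    rw [sum_Su]; rfl
  have hmUb : LeafStep.mU p ends a₁ a₂ b = ∑ W : Finset V, Su p ends a₁ a₂ x b W := by
    rw [sum_Su]; rfl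
  unfold FMfun gamma0
  rw [hmUo, hmUb, sum_Su_o_cross h ha1 ho ha2, sum_Su_b_cross h ha1 ha2 hb,
    sum_term_cross hp h ha1 ho ha2 hb, sum_Ssig_b_cross h ha1 ha2 hb, sum_SFg_cross h ha1 ho ha2,
    sum_termA_cross hp h ha1 ho ha2 hb, sum_SuA_b_cross h ha1 ha2 hb, sum_SuA_o_cross h ha1 ho ha2,
    prob_PD_cross h ha1 ha2]
  rw [← sum_mW p ends a₁ a₂ x, sum_mW_cross h ha1 ha2] at hQ ⊢
  rw [show ∑ T ∈ ((insert x VB).powerset.filter (fun T => x ∈ T)).filter (fun T => a₂ ∉ T),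
      muT p ends EB x T = 1 -
      ∑ T ∈ ((insert x VB).powerset.filter (fun T => x ∈ T)).filter (fun T => a₂ ∈ T),
        muT p ends EB x T from by linarith] at hQ ⊢
  set PQ := (∑ T ∈ ((insert x VB).powerset.filter (fun T => x ∈ T)).filter (fun T => a₂ ∈ T),
      muT p ends EB x T) * ∑ S ∈ VA.powerset.filter (fun S => a₁ ∉ S), alphaS p ends EA x S +
    (1 - ∑ T ∈ ((insert x VB).powerset.filter (fun T => x ∈ T)).filter (fun T => a₂ ∈ T),
      muT p ends EB x T) *
      (∑ S ∈ VA.powerset.filter (fun S => a₁ ∈ S), alphaS p ends EA x S +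
        ∑ S ∈ VA.powerset.filter (fun S => a₁ ∉ S), alphaS p ends EA x S) with hPQ
  field_simp
  ring

end FM

end CrossShield

end A3Fibre

end CovForm

end Summit.Ventures.PercRepro2
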